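import Summits.QuantumFields.YangMills.Theorems.FluctuationComparisonRegPrIntLS1aTowerFullWindow
import HarnessLib

/-!
# `FluctuationComparisonRegPrIntLS1aTowerSfCutDock` — THE LINE'S OWN CUT `sfCut` (numerals (½, 24∕25)) DOCKED INTO ✓`…S1aTowerFullWindow`: S1aᴴ's (p) ∧ (w) for the
# `sfCut`-cut tower with NO hypothesis on the cut left, plus the two-sided a.e. sandwich — the `∃ ρ, ∀ j ≥ jV, …` shape the line file can consume by `obtain`

Cell `ym3-torus` (YM ladder rung R3 = continuum `SU(2)` Yang–Mills on T³ — NOT d = 4, NOT infinite volume, NOT a mass gap, NOT Clay); width seat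
`ym3-torus-px21` (gen 22), WIDTH COPY of ★p1 «CMP 102 Thm 1's inputs AS PRINTED vs AS TYPED, every gap named».  Helper of the crux
`stmt-QuantumFields-20520` `FluctuationComparisonRegPrIntL` (`--kind proof --supports … --as helper`, count-neutral).  THEOREMS ONLY: definition-free,
default heartbeats, no `instance`∕`notation`.

WHAT.  `Lines/runpair_organ.lean` (v18.4) defines its tower cut as the TERM `sfCut θ U = ∏ p, max 0 (min 1 ((24∕25·θ − dist1 (U(∂p))) ∕ ((24∕25 − 1∕2)·θ)))` (R-CUT-χ numerals
(½, 24∕25); the `Cruxes` module is not importable, so this file speaks about the TERM — `sfCut θ U` δ-reduces to it).  §1 proves the five facts the abstract-cut theorems of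
✓p819387 ∕ ✓p819880 ∕ ✓C3 ask of a cut: measurability, `≤ 1`, `0 ≤`, PLATEAU «`= 1` on `PlaqSmall (θ∕2)`», SUPPORT «`> 0` on `PlaqSmall (c·θ)` for every `c ≤ 24∕25`» (the older
(`3 − 4·dist1∕θ`) term's twins are ✓`OrganTangentFibreMeanTools.sfCutTerm_*`).  §2 docks them: ★★★`exists_density_pos_on_fullWindow_sfCut` — for the `sfCut (θBal F.L γ b₀ p₀ ·)`-cut
tower of S1aᴴ (run hypotheses `hν1 hν2`, anchor `hanch`, cut `hcut` VERBATIM in S1aᴴ's shape with the term in place of `sfCut`), for `0 < γ ≤ γ₁(L, b₀, p₀)` and every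
`jV ≤ j ≤ K`: `∃ ρ` measurable, `0 ≤ ρ`, `μ j = dU_j.withDensity (ofReal ∘ ρ)`, `0 < ρ` on the FULL `θBal F.L γ b₀ p₀ j`-window, and a.e.
`Z_K⁻¹·heightDensity … (histGood F ℰp (θBal F.L γ (b₀∕2) p₀) K j) ≤ ρ ≤ Z_K⁻¹·heightDensity … univ` (lower edge: ✓p819387 `density_sandwich_ae` at the plateau `b₀∕2`,
`θBal (b₀∕2) = θBal b₀ ∕ 2`); ★★★`exists_densities_sfCut` — ONE family `ρ : (j : ℕ) → …` for all `jV ≤ j ≤ K` (S1aᴴ's `∃ ρ, ∀ j …` shape).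
NOTHING of Bałaban's is asserted or proved.

HONEST: (p) ∧ (w) of S1aᴴ for one measurable version, from a height — by kernel; S1a(ᴴ): (m)-conjunct AS TYPED misstated by currency (★★OWNER RULING №80; repair (R-β1′) requested),
AS PRINTED OPEN; (c)∕(a) untouched; the five registered stubs of `Lines/semiclassical_s2beta.lean` (3732b7df) ∕ crux 20520 ∕ 19936 ∕ 19200 ∕ `YM3TorusSU2` NOT proved; registry
untouched; rung R3 = SU(2) YM₃ on T³ at fixed lattice data — NOT d = 4, NOT infinite volume, NOT a mass gap, NOT Clay; the Yang–Mills mass gap is NOT proved by any of this.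
References: [Balaban1985UV3] CMP 102 (1985) (2) p. 256, (7) p. 257, (41) p. 266, (47) p. 267; [Balaban1987RG1] CMP 109 (1987) (0.4) p. 253.
-/

set_option autoImplicit false

noncomputable section

namespace Summit.QuantumFields.YangMills.Theorems.FluctuationComparisonRegPrIntLS1aTowerSfCutDock

open MeasureTheory Filter Topology Set Function
open scoped ENNReal NNReal BigOperators
open Literature.MathematicalPhysics.QuantumFieldTheory.Balaban1983to89
open T3ContinuumYM3Torus T3NestedUnitLaws T3UnitLawDensityEML T3UnitScaleTilt T3LevelShift T3TiltDescent T4Continuum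
open Literature.MathematicalPhysics.QuantumFieldTheory.Balaban1983to89.Missing
open scoped Literature.MathematicalPhysics.QuantumFieldTheory.Balaban1983to89.T3OrbitAverage
open Summit.QuantumFields.YangMills.Theorems.OrganTangentFibreMeanTools (continuous_dist1_plaqHol)
open Summit.QuantumFields.YangMills.Theorems.FluctuationComparisonRegPrIntLS1aTowerLawSandwich
open Summit.QuantumFields.YangMills.Theorems.FluctuationComparisonRegPrIntLS1aTowerFullWindow

/-! ## §1 The (½, 24∕25) cut term: measurability, bounds, plateau, support -/

section Term

variable {P : Params} {k : ℕ}

/-- The (½, 24∕25) cut term is continuous in the field. [folklore] -/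
theorem continuous_sfCut2425 (θ : ℝ) :
    Continuous fun U : GaugeField P k ↥(Matrix.specialUnitaryGroup (Fin 2) ℂ) =>
      ∏ p : Plaq P k, max 0 (min 1 ((24 / 25 * θ - dist1 (GaugeField.plaqHol U p)) / ((24 / 25 - 1 / 2) * θ))) :=
  continuous_finsetProd _ fun p _ =>
    continuous_const.max (continuous_const.min ((continuous_const.sub (continuous_dist1_plaqHol p)).div_const _))

/-- `ofReal` of the (½, 24∕25) cut term is measurable. [folklore] -/
theorem measurable_ofReal_sfCut2425 (θ : ℝ) :
    Measurable fun U : GaugeField P k ↥(Matrix.specialUnitaryGroup (Fin 2) ℂ) =>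
      ENNReal.ofReal (∏ p : Plaq P k, max 0 (min 1 ((24 / 25 * θ - dist1 (GaugeField.plaqHol U p)) / ((24 / 25 - 1 / 2) * θ)))) := by
  haveI : BorelSpace (GaugeField P k ↥(Matrix.specialUnitaryGroup (Fin 2) ℂ)) := T3OrbitAverage.instBorelSpaceGaugeField
  exact ENNReal.measurable_ofReal.comp (continuous_sfCut2425 θ).measurable

/-- The (½, 24∕25) cut term is non-negative. [folklore] -/
theorem sfCut2425_nonneg (θ : ℝ) (U : GaugeField P k ↥(Matrix.specialUnitaryGroup (Fin 2) ℂ)) :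
    0 ≤ ∏ p : Plaq P k, max 0 (min 1 ((24 / 25 * θ - dist1 (GaugeField.plaqHol U p)) / ((24 / 25 - 1 / 2) * θ))) :=
  Finset.prod_nonneg fun _ _ => le_max_left _ _

/-- The (½, 24∕25) cut term is at most one (as an extended non-negative real). [folklore] -/
theorem ofReal_sfCut2425_le_one (θ : ℝ) (U : GaugeField P k ↥(Matrix.specialUnitaryGroup (Fin 2) ℂ)) :
    ENNReal.ofReal (∏ p : Plaq P k, max 0 (min 1 ((24 / 25 * θ - dist1 (GaugeField.plaqHol U p)) / ((24 / 25 - 1 / 2) * θ)))) ≤ 1 :=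
  ENNReal.ofReal_le_one.mpr (Finset.prod_le_one (fun _ _ => le_max_left _ _) fun _ _ => max_le zero_le_one (min_le_left _ _))

/-- **PLATEAU**: on the half window `{PlaqSmall (θ∕2)}` the (½, 24∕25) cut term equals one (`θ > 0`). [cite: Balaban1985UV3, (7) p.257] -/
theorem ofReal_sfCut2425_eq_one_of_plaqSmall_half {θ : ℝ} (hθ : 0 < θ) (U : GaugeField P k ↥(Matrix.specialUnitaryGroup (Fin 2) ℂ))
    (hU : PlaqSmall (θ / 2) U) :
    ENNReal.ofReal (∏ p : Plaq P k, max 0 (min 1 ((24 / 25 * θ - dist1 (GaugeField.plaqHol U p)) / ((24 / 25 - 1 / 2) * θ)))) = 1 := by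
  rw [← ENNReal.ofReal_one]
  congr 1
  refine Finset.prod_eq_one fun p _ => ?_
  have hp : dist1 (GaugeField.plaqHol U p) < θ / 2 := hU p
  have h1 : 1 ≤ (24 / 25 * θ - dist1 (GaugeField.plaqHol U p)) / ((24 / 25 - 1 / 2) * θ) := by
    rw [le_div_iff₀ (by nlinarith)]; nlinarith
  rw [min_eq_left h1, max_eq_right zero_le_one]

/-- **SUPPORT**: on the `c·θ`-window with `c ≤ 24∕25` the (½, 24∕25) cut term is STRICTLY POSITIVE (`θ > 0`): every ramp factor is positive there. [cite: Balaban1985UV3, (7) p.257] -/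
theorem ofReal_sfCut2425_ne_zero_of_plaqSmall {θ c : ℝ} (hθ : 0 < θ) (hc : c ≤ 24 / 25) (U : GaugeField P k ↥(Matrix.specialUnitaryGroup (Fin 2) ℂ))
    (hU : PlaqSmall (c * θ) U) :
    ENNReal.ofReal (∏ p : Plaq P k, max 0 (min 1 ((24 / 25 * θ - dist1 (GaugeField.plaqHol U p)) / ((24 / 25 - 1 / 2) * θ)))) ≠ 0 := by
  rw [ne_eq, ENNReal.ofReal_eq_zero, not_le]
  refine Finset.prod_pos fun p _ => ?_
  have hp : dist1 (GaugeField.plaqHol U p) < c * θ := hU p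
  have h1 : 0 < (24 / 25 * θ - dist1 (GaugeField.plaqHol U p)) / ((24 / 25 - 1 / 2) * θ) := by
    refine div_pos ?_ (by nlinarith)
    nlinarith
  exact lt_max_of_lt_right (lt_min one_pos h1)

end Term

/-! ## §2 Docking: S1aᴴ's (p) ∧ (w) for the `sfCut`-cut tower, no hypothesis on the cut left -/

/-- ★★★ **S1aᴴ's (p) ∧ (w) FOR THE LINE'S OWN CUT, FULL WINDOW, FOR ONE MEASURABLE VERSION**: for every `L`, `0 < b₀`, `0 < p₀` there is `γ₁ > 0` such that for every family of block
size `L` and `0 < γ ≤ γ₁` there is a height `jV` with: for every run system `ν` and every `sfCut (θBal F.L γ b₀ p₀ ·)`-cut tower `μ` of S1aᴴ's shape (seed height `Ts ≤ K`) and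
every `jV ≤ j ≤ K`, `∃ ρ` measurable, `0 ≤ ρ`, `μ j = dU_j.withDensity (ofReal ∘ ρ)`, `0 < ρ` on the FULL `θBal F.L γ b₀ p₀ j`-window, and a.e.
`Z_K⁻¹·heightDensity … (histGood F ℰp (θBal F.L γ (b₀∕2) p₀) K j) ≤ ρ ≤ Z_K⁻¹·heightDensity … univ`. [cite: Balaban1985UV3, (2) p.256, (7) p.257, (41) p.266 and (47) p.267] -/
theorem exists_density_pos_on_fullWindow_sfCut (L : ℕ) {b₀ p₀ : ℝ} (hb : 0 < b₀) (hp : 0 < p₀) :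
    ∃ γ₁ : ℝ, 0 < γ₁ ∧ ∀ (F : T3Family) (γ : ℝ), F.L = L → 0 < γ → γ ≤ γ₁ → ∃ jV : ℕ,
      ∀ (ν : ℕ → (j : ℕ) → Measure (GaugeField (F.P j) 0 ↥(Matrix.specialUnitaryGroup (Fin 2) ℂ))),
        (∀ K, ν K K = T4GenFunBounds.gibbsMeasure (F.P K) ((F.scheme ℰp γ).β K)) →
        (∀ K j, j < K → ν K j = Measure.map (descend F ℰp j) (ν K (j + 1))) →
      ∀ (K Ts : ℕ) (_ : Ts ≤ K) (μ : (j : ℕ) → Measure (GaugeField (F.P j) 0 ↥(Matrix.specialUnitaryGroup (Fin 2) ℂ))),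
        (∀ j, Ts ≤ j → μ j = ν K j) →
        (∀ j, j < Ts → μ j = Measure.map (descend F ℰp j) ((μ (j + 1)).withDensity (fun U => ENNReal.ofReal
          (∏ p : Plaq (F.P (j + 1)) 0, max 0 (min 1 ((24 / 25 * θBal F.L γ b₀ p₀ (j + 1) - dist1 (GaugeField.plaqHol U p)) /
            ((24 / 25 - 1 / 2) * θBal F.L γ b₀ p₀ (j + 1)))))))) →
      ∀ (j : ℕ) (_ : jV ≤ j) (hjK : j ≤ K),
        ∃ ρ : GaugeField (F.P j) 0 ↥(Matrix.specialUnitaryGroup (Fin 2) ℂ) → ℝ, Measurable ρ ∧ (∀ V, 0 ≤ ρ V) ∧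
          μ j = (fieldMeasure (F.P j) 0 ↥(Matrix.specialUnitaryGroup (Fin 2) ℂ)).withDensity (fun V => ENNReal.ofReal (ρ V)) ∧
          (∀ V, PlaqSmall (θBal F.L γ b₀ p₀ j) V → 0 < ρ V) ∧
          (∀ᵐ V ∂fieldMeasure (F.P j) 0 ↥(Matrix.specialUnitaryGroup (Fin 2) ℂ),
            (partitionFn (G := ↥(Matrix.specialUnitaryGroup (Fin 2) ℂ)) (F.P K) ((F.scheme ℰp γ).β K))⁻¹ *
                heightDensity F γ hjK (histGood F ℰp (θBal F.L γ (b₀ / 2) p₀) K j) V ≤ ρ V ∧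
              ρ V ≤ (partitionFn (G := ↥(Matrix.specialUnitaryGroup (Fin 2) ℂ)) (F.P K) ((F.scheme ℰp γ).β K))⁻¹ * heightDensity F γ hjK Set.univ V) := by
  obtain ⟨γ₁, hγ₁, H⟩ := exists_density_pos_on_fullWindow L hb hp
  refine ⟨min γ₁ 1, lt_min hγ₁ one_pos, fun F γ hFL hγ hγle => ?_⟩
  have hγ₁' : γ ≤ γ₁ := hγle.trans (min_le_left _ _)
  have hγ1 : γ ≤ 1 := hγle.trans (min_le_right _ _)
  have hLF : 1 ≤ F.L := F.hL.2.le
  obtain ⟨jV, HV⟩ := H F γ hFL hγ hγ₁'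
  -- the cut, as a family of `ℝ≥0∞`-valued weights
  set χ : (i : ℕ) → GaugeField (F.P i) 0 ↥(Matrix.specialUnitaryGroup (Fin 2) ℂ) → ℝ≥0∞ := fun i U => ENNReal.ofReal
    (∏ p : Plaq (F.P i) 0, max 0 (min 1 ((24 / 25 * θBal F.L γ b₀ p₀ i - dist1 (GaugeField.plaqHol U p)) /
      ((24 / 25 - 1 / 2) * θBal F.L γ b₀ p₀ i)))) with hχdef
  have hχm : ∀ i, Measurable (χ i) := fun i => measurable_ofReal_sfCut2425 _
  have hχ1 : ∀ i U, χ i U ≤ 1 := fun i U => ofReal_sfCut2425_le_one _ U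
  have hθpos : ∀ i, 0 < θBal F.L γ b₀ p₀ i := fun i => T3MinimiserStabilityReduction.θBal_pos hLF hγ hγ1 hb p₀ i
  have hχpos : ∀ (j i : ℕ), j < i → ∀ U, PlaqSmall (19 / 20 * θBal F.L γ b₀ p₀ i) U → χ i U ≠ 0 :=
    fun j i _ U hU => ofReal_sfCut2425_ne_zero_of_plaqSmall (hθpos i) (by norm_num) U hU
  -- the plateau at `b₀∕2`: `θBal (b₀∕2) = θBal b₀ ∕ 2`
  have hhalf : ∀ i, θBal F.L γ (b₀ / 2) p₀ i = θBal F.L γ b₀ p₀ i / 2 := by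
    intro i; unfold θBal B10.pFun; ring
  have hplat : ∀ (i : ℕ) (U : GaugeField (F.P i) 0 ↥(Matrix.specialUnitaryGroup (Fin 2) ℂ)), PlaqSmall (θBal F.L γ (b₀ / 2) p₀ i) U → χ i U = 1 :=
    fun i U hU => ofReal_sfCut2425_eq_one_of_plaqSmall_half (hθpos i) U (by rw [← hhalf i]; exact hU)
  refine ⟨jV, fun ν hν1 hν2 K Ts hTs μ hanch hcut j hjV hjK => ?_⟩
  have hcut' : ∀ j, j < Ts → μ j = Measure.map (descend F ℰp j) ((μ (j + 1)).withDensity (χ (j + 1))) := hcut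
  obtain ⟨ρ, hρm, hρ0, hμρ, hpos, hup⟩ :=
    HV χ hχm hχ1 ν hν1 hν2 K Ts hTs μ hanch hcut' j hjV hjK (fun i hji _ U hU => hχpos j i hji U hU)
  refine ⟨ρ, hρm, hρ0, hμρ, hpos, ?_⟩
  -- the lower edge from ✓p819387 at the plateau `b₀∕2`
  obtain ⟨hlow, -⟩ := density_sandwich_ae F χ ν μ hγ.le hχm hχ1 hν1 hν2 hTs hanch hcut' hjK
    (fun i _ _ U hU => hplat i U hU) (ENNReal.measurable_ofReal.comp hρm) hμρ
  have hZ : 0 < partitionFn (G := ↥(Matrix.specialUnitaryGroup (Fin 2) ℂ)) (F.P K) ((F.scheme ℰp γ).β K) := partitionFn_pos' _ (F.scheme_β_nonneg ℰp hγ.le K)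
  filter_upwards [hlow, hup] with V h1 h2
  exact ⟨(ENNReal.ofReal_le_ofReal_iff (hρ0 V)).mp h1, h2⟩

/-- ★★★ **ONE FAMILY OF VERSIONS FOR ALL HEIGHTS `jV ≤ j ≤ K`** — S1aᴴ's `∃ ρ, ∀ j …, (p) ∧ (w)` shape for the line's own cut, with the two-sided a.e. sandwich.
[cite: Balaban1985UV3, (2) p.256, (7) p.257, (41) p.266 and (47) p.267] -/
theorem exists_densities_sfCut (L : ℕ) {b₀ p₀ : ℝ} (hb : 0 < b₀) (hp : 0 < p₀) :
    ∃ γ₁ : ℝ, 0 < γ₁ ∧ ∀ (F : T3Family) (γ : ℝ), F.L = L → 0 < γ → γ ≤ γ₁ → ∃ jV : ℕ,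
      ∀ (ν : ℕ → (j : ℕ) → Measure (GaugeField (F.P j) 0 ↥(Matrix.specialUnitaryGroup (Fin 2) ℂ))),
        (∀ K, ν K K = T4GenFunBounds.gibbsMeasure (F.P K) ((F.scheme ℰp γ).β K)) →
        (∀ K j, j < K → ν K j = Measure.map (descend F ℰp j) (ν K (j + 1))) →
      ∀ (K Ts : ℕ) (_ : Ts ≤ K) (μ : (j : ℕ) → Measure (GaugeField (F.P j) 0 ↥(Matrix.specialUnitaryGroup (Fin 2) ℂ))),
        (∀ j, Ts ≤ j → μ j = ν K j) →
        (∀ j, j < Ts → μ j = Measure.map (descend F ℰp j) ((μ (j + 1)).withDensity (fun U => ENNReal.ofReal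
          (∏ p : Plaq (F.P (j + 1)) 0, max 0 (min 1 ((24 / 25 * θBal F.L γ b₀ p₀ (j + 1) - dist1 (GaugeField.plaqHol U p)) /
            ((24 / 25 - 1 / 2) * θBal F.L γ b₀ p₀ (j + 1)))))))) →
        ∃ ρ : (j : ℕ) → GaugeField (F.P j) 0 ↥(Matrix.specialUnitaryGroup (Fin 2) ℂ) → ℝ,
          ∀ (j : ℕ) (_ : jV ≤ j) (hjK : j ≤ K), Measurable (ρ j) ∧ (∀ V, 0 ≤ ρ j V) ∧
            μ j = (fieldMeasure (F.P j) 0 ↥(Matrix.specialUnitaryGroup (Fin 2) ℂ)).withDensity (fun V => ENNReal.ofReal (ρ j V)) ∧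
            (∀ V, PlaqSmall (θBal F.L γ b₀ p₀ j) V → 0 < ρ j V) ∧
            (∀ᵐ V ∂fieldMeasure (F.P j) 0 ↥(Matrix.specialUnitaryGroup (Fin 2) ℂ),
              (partitionFn (G := ↥(Matrix.specialUnitaryGroup (Fin 2) ℂ)) (F.P K) ((F.scheme ℰp γ).β K))⁻¹ *
                  heightDensity F γ hjK (histGood F ℰp (θBal F.L γ (b₀ / 2) p₀) K j) V ≤ ρ j V ∧
                ρ j V ≤ (partitionFn (G := ↥(Matrix.specialUnitaryGroup (Fin 2) ℂ)) (F.P K) ((F.scheme ℰp γ).β K))⁻¹ * heightDensity F γ hjK Set.univ V) := by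
  classical
  obtain ⟨γ₁, hγ₁, H⟩ := exists_density_pos_on_fullWindow_sfCut L hb hp
  refine ⟨γ₁, hγ₁, fun F γ hFL hγ hγle => ?_⟩
  obtain ⟨jV, HV⟩ := H F γ hFL hγ hγle
  refine ⟨jV, fun ν hν1 hν2 K Ts hTs μ hanch hcut => ?_⟩
  have H' : ∀ (j : ℕ) (h : jV ≤ j ∧ j ≤ K), ∃ ρ : GaugeField (F.P j) 0 ↥(Matrix.specialUnitaryGroup (Fin 2) ℂ) → ℝ, Measurable ρ ∧ (∀ V, 0 ≤ ρ V) ∧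
      μ j = (fieldMeasure (F.P j) 0 ↥(Matrix.specialUnitaryGroup (Fin 2) ℂ)).withDensity (fun V => ENNReal.ofReal (ρ V)) ∧
      (∀ V, PlaqSmall (θBal F.L γ b₀ p₀ j) V → 0 < ρ V) ∧
      (∀ᵐ V ∂fieldMeasure (F.P j) 0 ↥(Matrix.specialUnitaryGroup (Fin 2) ℂ),
        (partitionFn (G := ↥(Matrix.specialUnitaryGroup (Fin 2) ℂ)) (F.P K) ((F.scheme ℰp γ).β K))⁻¹ *
            heightDensity F γ h.2 (histGood F ℰp (θBal F.L γ (b₀ / 2) p₀) K j) V ≤ ρ V ∧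
          ρ V ≤ (partitionFn (G := ↥(Matrix.specialUnitaryGroup (Fin 2) ℂ)) (F.P K) ((F.scheme ℰp γ).β K))⁻¹ * heightDensity F γ h.2 Set.univ V) :=
    fun j h => HV ν hν1 hν2 K Ts hTs μ hanch hcut j h.1 h.2
  choose ρ hρ using H'
  refine ⟨fun j => if h : jV ≤ j ∧ j ≤ K then ρ j h else fun _ => 0, fun j hjV hjK => ?_⟩
  have h : jV ≤ j ∧ j ≤ K := ⟨hjV, hjK⟩
  simp only [dif_pos h]
  exact hρ j h

end Summit.QuantumFields.YangMills.Theorems.FluctuationComparisonRegPrIntLS1aTowerSfCutDock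

end
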